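import Mathlib
import Summits.Ventures.PercRepro.TriangleCapSubBandBound

/-!
# PercRepro — THE SUB-BAND `u = 2` IS EXACTLY `[2 t − 6, 2 t − 6 + ℓ]` (p3, gen 52; part 258)

On `ℓ + 1 + (s − t)` vertices (`2 ≤ ℓ`, `4 ≤ t`, `2 t ≤ s`) every `j = 2 t − 6 + m`, `m ≤ ℓ`, is attained
(`twoWitness`): the `(t − 2)`-star at the non-neighbour `1` with `e` ends at non-leaves, plus two edges from the
non-neighbour `2` to leaves, `c` of them leaves of the star (`c ≤ 2`, right collisions `2 c`): `attach = t − e`,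
`coll lf = (t − 2)(t − 3) + 2`, `coll rf = 2 c`, so `j = 2 t − 4 + e − c`; `m = e + 2 − c` runs over `0 … ℓ`.  With
the bounds of parts 252 and 257 (`2 (t − 3) ≤ j ≤ 2 t − 6 + ℓ` at a non-neighbour of off-degree `t − 2`) the
sub-band `u = 2` is exactly this interval.  Axioms: standard.
-/

namespace PercRepro

namespace TriangleCap

namespace C047

open Finset

/-- The left ends: `1` for the `t − 2` star pairs, `2` for the two extra pairs. -/
def lfTwo (t i : ℕ) : ℕ := if i < t - 2 then 1 else 2

/-- The right ends: `e` non-leaves, then the leaves `3, 4, …` for the star; the extra pairs at the leaves `3` and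
`4` when `1 ≤ c` / `c = 2`, else at fresh leaves. -/
def rfTwo (s t e c i : ℕ) : ℕ :=
  if i < e then 3 + (s - t) + i
  else if i < t - 2 then 3 + (i - e)
  else if i = t - 2 then (if 1 ≤ c then 3 else 3 + (t - 2 - e))
  else (if c = 2 then 4 else 3 + (t - 1 - e))

/-- `coll` of the two-pair left ends: `(t − 2)(t − 3) + 2`. -/
theorem coll_lfTwo (t : ℕ) (ht : 4 ≤ t) : coll t (lfTwo t) = (t - 2) * (t - 3) + 2 := by
  rw [coll_eq_sum_cls t (lfTwo t) {1, 2} (fun i _ => by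
    simp only [mem_insert, mem_singleton]
    unfold lfTwo
    split_ifs <;> omega)]
  rw [sum_pair (by norm_num)]
  have h1 : cls t (lfTwo t) 1 = t - 2 := by
    unfold cls
    have : (range t).filter (fun i => lfTwo t i = 1) = range (t - 2) := by
      ext i
      simp only [mem_filter, mem_range]
      unfold lfTwo
      split_ifs <;> omega
    rw [this, card_range]
  have h2 : cls t (lfTwo t) 2 = 2 := by
    unfold cls
    have : (range t).filter (fun i => lfTwo t i = 2) = {t - 2, t - 1} := by
      ext i
      simp only [mem_filter, mem_range, mem_insert, mem_singleton]
      unfold lfTwo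
      split_ifs <;> omega
    rw [this, card_pair (by omega)]
  rw [h1, h2]
  have : t - 2 - 1 = t - 3 := by omega
  rw [this]

/-- The regions of the two-pair right ends. -/
theorem rfTwo_cases (s t e c i : ℕ) (hi : i < t) (he : e + 4 ≤ t) :
    (i < e ∧ rfTwo s t e c i = 3 + (s - t) + i) ∨ (e ≤ i ∧ i < t - 2 ∧ rfTwo s t e c i = 3 + (i - e)) ∨
      i = t - 2 ∨ i = t - 1 := by
  unfold rfTwo
  by_cases h1 : i < e
  · left
    exact ⟨h1, by rw [if_pos h1]⟩
  · by_cases h2 : i < t - 2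
    · right; left
      exact ⟨by omega, h2, by rw [if_neg h1, if_pos h2]⟩
    · right; right
      omega

/-- The value at `t − 2`. -/
theorem rfTwo_pen (s t e c : ℕ) (he : e + 4 ≤ t) :
    rfTwo s t e c (t - 2) = if 1 ≤ c then 3 else 3 + (t - 2 - e) := by
  unfold rfTwo
  rw [if_neg (by omega), if_neg (by omega), if_pos rfl]

/-- The value at `t − 1`. -/
theorem rfTwo_last (s t e c : ℕ) (he : e + 4 ≤ t) :
    rfTwo s t e c (t - 1) = if c = 2 then 4 else 3 + (t - 1 - e) := by
  unfold rfTwo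
  rw [if_neg (by omega), if_neg (by omega), if_neg (by omega)]

/-- The value at `e` (the first leaf, `3`) and at `e + 1` (the second leaf, `4`). -/
theorem rfTwo_leaf (s t e c : ℕ) (he : e + 4 ≤ t) :
    rfTwo s t e c e = 3 ∧ rfTwo s t e c (e + 1) = 4 := by
  unfold rfTwo
  rw [if_neg (lt_irrefl e), if_pos (by omega), if_neg (by omega), if_pos (by omega)]
  omega

/-- `coll` of the two-pair right ends with no shared leaf: `0`. -/
theorem coll_rfTwo_zero (s t e : ℕ) (hs : 2 * t ≤ s) (he : e + 4 ≤ t) : coll t (rfTwo s t e 0) = 0 := by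
  apply coll_eq_zero_of_injOn
  intro i i' hi hi' h4
  have hA := rfTwo_pen s t e 0 he
  have hB := rfTwo_last s t e 0 he
  rw [if_neg (by norm_num)] at hA
  rw [if_neg (by norm_num)] at hB
  rcases rfTwo_cases s t e 0 i hi he with ⟨hi1, hv⟩ | ⟨hi1, hi2, hv⟩ | hv | hv <;>
    rcases rfTwo_cases s t e 0 i' hi' he with ⟨hj1, hw⟩ | ⟨hj1, hj2, hw⟩ | hw | hw <;>
    simp only [hv, hw, hA, hB] at h4 <;> omega

/-- `coll` of the two-pair right ends with one shared leaf: `2`. -/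
theorem coll_rfTwo_one (s t e : ℕ) (hs : 2 * t ≤ s) (he : e + 4 ≤ t) : coll t (rfTwo s t e 1) = 2 := by
  unfold coll
  have hA := rfTwo_pen s t e 1 he
  have hB := rfTwo_last s t e 1 he
  rw [if_pos (by norm_num)] at hA
  rw [if_neg (by norm_num)] at hB
  have hL := rfTwo_leaf s t e 1 he
  have hset : (range t).offDiag.filter (fun p : ℕ × ℕ => rfTwo s t e 1 p.1 = rfTwo s t e 1 p.2) =
      {(e, t - 2), (t - 2, e)} := by
    ext ⟨i, i'⟩
    simp only [mem_filter, mem_offDiag, mem_range, mem_insert, mem_singleton, Prod.mk.injEq]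
    constructor
    · rintro ⟨⟨h1, h2, h3⟩, h4⟩
      rcases rfTwo_cases s t e 1 i h1 he with ⟨hi1, hv⟩ | ⟨hi1, hi2, hv⟩ | hv | hv <;>
        rcases rfTwo_cases s t e 1 i' h2 he with ⟨hj1, hw⟩ | ⟨hj1, hj2, hw⟩ | hw | hw <;>
        simp only [hv, hw, hA, hB] at h4 <;> omega
    · rintro (⟨rfl, rfl⟩ | ⟨rfl, rfl⟩)
      · exact ⟨⟨by omega, by omega, by omega⟩, by rw [hL.1, hA]⟩
      · exact ⟨⟨by omega, by omega, by omega⟩, by rw [hL.1, hA]⟩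
  rw [hset, card_pair]
  intro h
  rw [Prod.mk.injEq] at h
  omega

/-- `coll` of the two-pair right ends with two shared leaves: `4`. -/
theorem coll_rfTwo_two (s t e : ℕ) (hs : 2 * t ≤ s) (he : e + 4 ≤ t) : coll t (rfTwo s t e 2) = 4 := by
  unfold coll
  have hA := rfTwo_pen s t e 2 he
  have hB := rfTwo_last s t e 2 he
  rw [if_pos (by norm_num)] at hA
  rw [if_pos rfl] at hB
  have hL := rfTwo_leaf s t e 2 he
  have hset : (range t).offDiag.filter (fun p : ℕ × ℕ => rfTwo s t e 2 p.1 = rfTwo s t e 2 p.2) =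
      {(e, t - 2), (t - 2, e), (e + 1, t - 1), (t - 1, e + 1)} := by
    ext ⟨i, i'⟩
    simp only [mem_filter, mem_offDiag, mem_range, mem_insert, mem_singleton, Prod.mk.injEq]
    constructor
    · rintro ⟨⟨h1, h2, h3⟩, h4⟩
      rcases rfTwo_cases s t e 2 i h1 he with ⟨hi1, hv⟩ | ⟨hi1, hi2, hv⟩ | hv | hv <;>
        rcases rfTwo_cases s t e 2 i' h2 he with ⟨hj1, hw⟩ | ⟨hj1, hj2, hw⟩ | hw | hw <;>
        simp only [hv, hw, hA, hB] at h4 <;> omega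
    · rintro (⟨rfl, rfl⟩ | ⟨rfl, rfl⟩ | ⟨rfl, rfl⟩ | ⟨rfl, rfl⟩)
      · exact ⟨⟨by omega, by omega, by omega⟩, by rw [hL.1, hA]⟩
      · exact ⟨⟨by omega, by omega, by omega⟩, by rw [hL.1, hA]⟩
      · exact ⟨⟨by omega, by omega, by omega⟩, by rw [hL.2, hB]⟩
      · exact ⟨⟨by omega, by omega, by omega⟩, by rw [hL.2, hB]⟩
  rw [hset]
  have h1 : ((e, t - 2) : ℕ × ℕ) ∉ ({(t - 2, e), (e + 1, t - 1), (t - 1, e + 1)} : Finset (ℕ × ℕ)) := by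
    simp only [mem_insert, mem_singleton, Prod.mk.injEq, not_or]
    omega
  have h2 : ((t - 2, e) : ℕ × ℕ) ∉ ({(e + 1, t - 1), (t - 1, e + 1)} : Finset (ℕ × ℕ)) := by
    simp only [mem_insert, mem_singleton, Prod.mk.injEq, not_or]
    omega
  have h3 : ((e + 1, t - 1) : ℕ × ℕ) ≠ (t - 1, e + 1) := by
    intro h
    rw [Prod.mk.injEq] at h
    omega
  rw [card_insert_of_notMem h1, card_insert_of_notMem h2, card_pair h3]

/-- `coll` of the two-pair right ends: `2 c` for `c ≤ 2`. -/
theorem coll_rfTwo (s t e c : ℕ) (hs : 2 * t ≤ s) (he : e + 4 ≤ t) (hc : c ≤ 2) :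
    coll t (rfTwo s t e c) = 2 * c := by
  rcases c with _ | _ | _ | c'
  · rw [coll_rfTwo_zero s t e hs he]
  · rw [coll_rfTwo_one s t e hs he]
  · rw [coll_rfTwo_two s t e hs he]
  · omega

/-- The attach count of the two-pair witness: `t − e` (the `t − 2 − e` star leaves and the two extra pairs). -/
theorem card_filter_rfTwo (s t e c : ℕ) (ht : 4 ≤ t) (hs : 2 * t ≤ s) (he : e + 4 ≤ t) :
    ((range t).filter (fun i => rfTwo s t e c i < 3 + (s - t))).card = t - e := by
  have : (range t).filter (fun i => rfTwo s t e c i < 3 + (s - t)) = Ico e t := by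
    ext i
    simp only [mem_filter, mem_range, mem_Ico]
    unfold rfTwo
    split_ifs <;> omega
  rw [this, Nat.card_Ico]

/-- **THE SUB-BAND `u = 2` IS ATTAINED IN FULL:** every `j = 2 t − 6 + m`, `m ≤ ℓ`, is attained on
`ℓ + 1 + (s − t)` vertices (`2 ≤ ℓ`, `ℓ + 2 ≤ t`, `4 ≤ t`, `2 t ≤ s`). -/
theorem twoWitness (ℓ s t m : ℕ) (hℓ : 2 ≤ ℓ) (ht : 4 ≤ t) (hℓt : ℓ + 2 ≤ t) (hs : 2 * t ≤ s) (hm : m ≤ ℓ) :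
    ∃ (H : SimpleGraph (Fin (ℓ + 1 + (s - t)))) (_ : DecidableRel H.Adj), H.CliqueFree 3 ∧
      H.edgeFinset.card = s ∧ (∃ w, deg H w + t = s) ∧
      ∑ v, deg H v * deg H v + 2 * (t * (s - t - 1)) + 2 * (2 * t - 6 + m) = s * (s + 1) := by
  -- `m = e + 2 − c` with `e ≤ ℓ − 2`, `c ≤ 2`
  obtain ⟨e, c, he, hc, hm'⟩ : ∃ e c, e + 2 ≤ ℓ ∧ c ≤ 2 ∧ m + c = e + 2 := by
    rcases Nat.lt_or_ge m 2 with h | h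
    · exact ⟨0, 2 - m, by omega, by omega, by omega⟩
    · exact ⟨m - 2, 0, by omega, by omega, by omega⟩
  set n := ℓ + 1 + (s - t) with hn
  have hn0 : 0 < n := by omega
  have he4 : e + 4 ≤ t := by omega
  have hg : GoodEnds n 3 t (lfTwo t) (rfTwo s t e c) := by
    refine ⟨fun i hi => ?_, fun i hi => ?_, fun i i' hi hi' h1 h2 => ?_⟩
    · unfold lfTwo
      split_ifs <;> omega
    · unfold rfTwo
      split_ifs <;> omega
    · unfold lfTwo at h1
      unfold rfTwo at h2
      split_ifs at h1 h2 <;> omega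
  have hval := genWitness_missing_value n 3 s t hn0 (lfTwo t) (rfTwo s t e c) hg (by omega) (by omega) (by omega)
    (by omega)
  rw [card_filter_rfTwo s t e c ht hs he4, coll_lfTwo t ht, coll_rfTwo s t e c hs he4 hc] at hval
  refine ⟨_, inferInstance, cliqueFree_of_bipSub _ _ (bipSub_missingGraph _ _),
    card_edges_missingGraph_genWitness n 3 s t hn0 (lfTwo t) (rfTwo s t e c) hg (by omega) (by omega) (by omega),
    ⟨fin' n hn0 0, by
      rw [deg_missingGraph_genWitness_zero n 3 s t hn0 (lfTwo t) (rfTwo s t e c) hg (by omega) (by omega)]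
      omega⟩, ?_⟩
  have e1 : t - (t - e) = e := by omega
  have e2 : t * (t - 1) - ((t - 2) * (t - 3) + 2 + 2 * c) = 4 * t - 8 - 2 * c := by
    obtain ⟨t', rfl⟩ : ∃ t', t = t' + 4 := ⟨t - 4, by omega⟩
    have h1 : t' + 4 - 1 = t' + 3 := by omega
    have h2 : t' + 4 - 2 = t' + 2 := by omega
    have h3 : t' + 4 - 3 = t' + 1 := by omega
    rw [h1, h2, h3]
    have : (t' + 4) * (t' + 3) = (t' + 2) * (t' + 1) + 2 + 2 * c + (4 * (t' + 4) - 8 - 2 * c) := by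
      have : 2 * c ≤ 4 * (t' + 4) - 8 := by omega
      zify [this, (by omega : 8 ≤ 4 * (t' + 4))]
      ring
    omega
  rw [e1, e2] at hval
  have e3 : 2 * (2 * t - 6 + m) = 2 * e + (4 * t - 8 - 2 * c) := by omega
  rw [e3]
  exact hval

/-- **THE SUB-BAND `u = 2`, EXACTLY:** on `ℓ + 1 + (s − t)` vertices (`2 ≤ ℓ`, `ℓ + 2 ≤ t`, `4 ≤ t`, `2 t ≤ s`) a
non-neighbour of `w` of off-degree `t − 2` forces `2 t − 6 ≤ j ≤ 2 t − 6 + ℓ`, and every such `j` is attained. -/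
theorem subband_two_exact (ℓ s t : ℕ) (hℓ : 2 ≤ ℓ) (ht : 4 ≤ t) (hℓt : ℓ + 2 ≤ t) (hs : 2 * t ≤ s) :
    (∀ (H : SimpleGraph (Fin (ℓ + 1 + (s - t)))) [DecidableRel H.Adj], H.CliqueFree 3 →
      H.edgeFinset.card = s → ∀ w, deg H w + t = s → ∀ j,
      ∑ v, deg H v * deg H v + 2 * (t * (s - t - 1)) + 2 * j = s * (s + 1) →
      ∀ x, offDeg H w x + 2 = t → ¬ H.Adj w x → 2 * t ≤ j + 6 ∧ j + 6 ≤ 2 * t + ℓ) ∧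
    ∀ j, 2 * t ≤ j + 6 → j + 6 ≤ 2 * t + ℓ →
      ∃ (H : SimpleGraph (Fin (ℓ + 1 + (s - t)))) (_ : DecidableRel H.Adj), H.CliqueFree 3 ∧
        H.edgeFinset.card = s ∧ (∃ w, deg H w + t = s) ∧
        ∑ v, deg H v * deg H v + 2 * (t * (s - t - 1)) + 2 * j = s * (s + 1) := by
  refine ⟨fun H _ hfree hs' w hw j hj x hx hxw => ?_, fun j hj1 hj2 => ?_⟩
  · have hw1 : 1 ≤ deg H w := by omega
    have hl := subband_lower_bound' H hfree s t 2 j hs' w hw1 hw hj x hx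
    have hu := subband_two_upper ℓ s t H hfree hs' w hw hw1 j hj x hx hxw (by omega) (by omega)
    have : 2 * (t - 2 - 1) = 2 * t - 6 := by omega
    omega
  · obtain ⟨m, rfl⟩ : ∃ m, j = 2 * t - 6 + m := ⟨j - (2 * t - 6), by omega⟩
    exact twoWitness ℓ s t m hℓ ht hℓt hs (by omega)

end C047

end TriangleCap

end PercRepro
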